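import Literature.IUT.HodgeArakelov.LabelClassesOfCuspsCor24iGenuineGraphTowerComap
import Literature.IUT.HodgeTheaters.StableCurveTemperedDataOfSpecialFibreProp24iByName
import HarnessLib

/-!
# [IUTchII] Cor 2.4 (i)′ AT THE GENUINE PAIR with the [IUTchI] Prop 2.4 (i) premise RE-KEYED onto abc-iut-L3's origin
# record `SpecialFibreTower.PiData` + the four printed (i)-side laws (proof-only twin of p440067)

S. Mochizuki, *Inter-universal Teichmüller Theory II*, kurims manuscript (Dec. 2020), §2, Cor 2.4 (i) pp. 69–71
[cite: Mochizuki2012, II Cor 2.4 (i) pp.69–71]; *… I* (May 2020), §2, Prop 2.4 (i) p. 50 with its proof p. 50 l. 25–51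
[cite: Mochizuki2012, Prop 2.4(i) p.50] (D-0012 claim key, status DISPUTED: every [IUTchI]/[IUTchII]/[SemiAnbd] statement
below is a HYPOTHESIS named by the tree's typed predicates or a kernel theorem about the tree's own constructions; nothing
printed is asserted); Mochizuki, *Semi-graphs of anabelioids*, Publ. RIMS **42** (2006), Ex 3.10 pp. 44–45
[cite: MochizukiSemiAnbd2006, Ex 3.10 p.44]; Hoshi–Mochizuki [NodNon] Lem 1.9 (ii) as abc-iut-L3's frozen predicate
`PSCDatum.VerticialIntersectionNear` (FACT-LIST F-2540) [cite: HoshiMochizukiNodNon2011, Lem 1.9 (ii) p.291].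

abc-iut cell, node **IUTchII:Cor2.4(i)** (lineage abc-iut-w4-d012; filed by abc-iut-L5-t11 gen 8 as the L5-side RE-KEY,
row «PROP24i-LAWS-AT-L6-PAIR» part 2, after first refusal to the abc-iut-w4-d012 / abc-iut-w6-d069 lineages).  PROOF-ONLY
(0 `def`, 0 instance, no new `Prop` fact): the statement of abc-iut-w4-d012's `cor24_i'_ofPiCHat_of_graphTower_comap`
(p440067) is reproduced VERBATIM except that its inner premise "[IUTchI] Prop 2.4 (i) of `X̲_v`'s datum"
(`(ofSpecialFibre …).Prop24i →`, an [IUTchI] node statement taken as a hypothesis) is REMOVED and replaced, in the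
outer signature, by abc-iut-L3's ORIGIN DATA for the special-fibre tower of `X̲_v` (`Tsf : SpecialFibreTower`,
`Psf : SpecialFibreTower.PiData`, [SemiAnbd] Ex 3.10) and the four (i)-side LAWS of [IUTchI] Prop 2.4 (i) in printed form
keyed on typed predicates — `hTF` ([Config] Rmk 1.2.2), `hNN_i` (F-2540 BY NAME, with per-level PSC identification
data), `hab` (pro-`Σ` abelianizations along the admissible quotients), `hadm` (the admissible kernels shrink to `1`) —
through abc-iut-L5-t11's `StableCurveTemperedData.OfSpecialFibre.prop24i_ofPiData_byName`.  Proof: p440067 + that one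
call.  Net effect for a certificate writer: the `h24i` binder of the [IUTchII] Cor 2.4 (i) node at the genuine pair is
no longer an [IUTchI] node statement but L3 origin data + four printed laws (typed ≠ discharged for those).

HONEST LABEL: conditional exactly as p440067 otherwise (binders `hZ`, `hN`, `hDopen`, the special-fibre DATA of `X̲_v`,
the per-`□` GraphTower inputs); nothing here takes a side on [IUTchIII] Cor. 3.12 or asserts anything of the series.
-/

noncomputable section

namespace Literature.IUT.HodgeArakelov

open Literature.AnabelianGeometry.EtaleTheta Literature.AnabelianGeometry.SemiGraphs Literature.IUT.HodgeTheaters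
open Literature.AnabelianGeometry.SemiGraphs.ProfiniteSemiGraph
open _root_.Topology
open scoped Pointwise

namespace PlusMinusTower

variable {p : ℕ} [Fact p.Prime] {M : MuTwoSetting p} (e : M.CLevelData)
  {E : M.toThetaSetting.EtaleThetaData} {l : ℕ} (C : E.DoubleUnderline l) {N : ℕ+}
  (μ : M.toThetaSetting.CyclotomeMod l N) (hC : M.toThetaSetting.Compat) (hS : M.toThetaSetting.Sec2Hyps)
  (hl : l.Prime) (hp2 : p ≠ 2) (hpl : p ≠ l) (hζ : ∃ ζ : M.toThetaSetting.K, IsPrimitiveRoot ζ (4 * l))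
  {η : (C.thetaEnvData μ hC hS).PiYdd → MuN p N} (hη : η ∈ (C.thetaEnvData μ hC hS).thetaCocycles)
  (hZ : Thm16Sub.KerToZIsCompactlyGenerated M.toThetaSetting) (hN : (C.Huu.subgroupOf (M.GtpXu l)).Normal)
  {P : TopGroup.{0}} (T : TemperedCoverings (BadPlaceSetting.ofUnderline C μ hC hS hl hp2 hpl hζ hη) P)

/-- **[IUTchII] Cor 2.4 (i)′ AT THE GENUINE PAIR, (B) over an admissible tower — [IUTchI] Prop 2.4 (i) NO LONGER A PREMISE**
(kurims pp. 69–71): abc-iut-w4-d012's `cor24_i'_ofPiCHat_of_graphTower_comap` (p440067) VERBATIM, with the inner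
`(ofSpecialFibre …).Prop24i →` REPLACED by abc-iut-L3's special-fibre-tower origin data `Tsf`/`Psf` of `X̲_v` and the
four printed (i)-side laws `hTF` · `hNN_i` (F-2540) · `hab` · `hadm` (+ per-level PSC identification data), via
abc-iut-L5-t11's `prop24i_ofPiData_byName`.  PROVED (p440067 + one call).
([IUTchII] Cor 2.4 (i), kurims pp.69–71) [claim: Mochizuki2012, status: disputed] -/
theorem cor24_i'_ofPiCHat_of_graphTower_comap_ofPiData [(M.GtpXu l).FiniteIndex] [FiniteDimensional ℚ_[p] M.K]
    (hDopen : ∀ (x : M.toTemperedCurve.Pt) (g : M.toTemperedCurve.PiTemp),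
      IsOpen (M.toTemperedCurve.aug '' ((M.toTemperedCurve.decompOfOpenAt (M.GtpXu l) x g).map (M.GtpXu l).subtype :
        Set M.toTemperedCurve.PiTemp)))
    (d : (M.toTemperedCurve.ofOpenSubgroup (M.GtpXu l) (M.toThetaSetting.isOpen_GtpXu l) M.K (range_aug_GtpXu_eq_GK C) hDopen).GroupLevelData)
    (Sf : SpecialFibreData ((M.toTemperedCurve.ofOpenSubgroup (M.GtpXu l) (M.toThetaSetting.isOpen_GtpXu l) M.K (range_aug_GtpXu_eq_GK C) hDopen).toTemperedArithmeticGroup d))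
    (h36 : Sf.Gc.Prop36Hypotheses) (Sigma SigmaHat : Set ℕ) (hsub : Sigma ⊆ SigmaHat) (hne : Sigma.Nonempty)
    (hprime : ∀ q ∈ SigmaHat, q.Prime) (hp : p ∉ Sigma) (TpH : Subgroup Sf.chart.G)
    (HatH : Subgroup (TemperedGraphGroupData.exists_completion_of_prop36 Sf.Gc h36 Sf.chart).choose)
    (hle : TpH.map (TemperedGraphGroupData.exists_completion_of_prop36 Sf.Gc h36 Sf.chart).choose_spec.choose.toMonoidHom ≤ HatH)
    (cuspMeetsH : {x : (M.toTemperedCurve.ofOpenSubgroup (M.GtpXu l) (M.toThetaSetting.isOpen_GtpXu l) M.K (range_aug_GtpXu_eq_GK C) hDopen).Pt // (M.toTemperedCurve.ofOpenSubgroup (M.GtpXu l) (M.toThetaSetting.isOpen_GtpXu l) M.K (range_aug_GtpXu_eq_GK C) hDopen).IsCusp x} → Prop)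
    {D : EtaleThetaData (BadPlaceSetting.ofUnderline C μ hC hS hl hp2 hpl hζ hη).toThetaSetting P}
    (Dec : SubgraphDecomposition (BadPlaceSetting.ofUnderline C μ hC hS hl hp2 hpl hζ hη) T D)
    -- abc-iut-L3's ORIGIN DATA for the special-fibre tower of `X̲_v` ([SemiAnbd] Ex 3.10) …
    (Tsf : SpecialFibreTower (M.toTemperedCurve.ofOpenSubgroup (M.GtpXu l) (M.toThetaSetting.isOpen_GtpXu l) M.K (range_aug_GtpXu_eq_GK C) hDopen).DeltaTemp)
    (Psf : SpecialFibreTower.PiData (M.toTemperedCurve.ofOpenSubgroup (M.GtpXu l) (M.toThetaSetting.isOpen_GtpXu l) M.K (range_aug_GtpXu_eq_GK C) hDopen) d Sf Tsf)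
    -- … and the (i)-side LAWS of [IUTchI] Prop 2.4 (i) at `X̲_v`'s datum (abc-iut-L5-t11 `prop24i_ofPiData_byName`):
    -- [Config] Rmk 1.2.2 in printed form on `Δ̂`
    (hTF : ∀ H : Subgroup (M.toTemperedCurve.ofOpenSubgroup (M.GtpXu l) (M.toThetaSetting.isOpen_GtpXu l) M.K (range_aug_GtpXu_eq_GK C) hDopen).DeltaHat, IsOpen (H : Set (M.toTemperedCurve.ofOpenSubgroup (M.GtpXu l) (M.toThetaSetting.isOpen_GtpXu l) M.K (range_aug_GtpXu_eq_GK C) hDopen).DeltaHat) →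
      ∀ (h : H) (n : ℕ), n ≠ 0 → SigmaCharDetects Set.univ H h → SigmaCharDetects Set.univ H (h ^ n))
    -- per-level PSC data on `Π̂_{𝔾_{J_i}}` with (A3) := F-2540 `VerticialIntersectionNear` BY NAME and the identification side conditions
    (G : ∀ i, PSCDatum (StableCurveTemperedData.OfSpecialFibre.levelGraph (M.toTemperedCurve.ofOpenSubgroup (M.GtpXu l) (M.toThetaSetting.isOpen_GtpXu l) M.K (range_aug_GtpXu_eq_GK C) hDopen) Tsf Sigma SigmaHat hsub hne hprime i).Hat)
    (hNN : ∀ i, (G i).VerticialIntersectionNear)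
    (σ : ∀ i, (Tsf.Gc i).graph.Vertex ≃ (G i).graph.V) (Λv : ∀ i, (G i).graph.V → Subgroup (Tsf.chart i).G)
    (hvert : ∀ i (v : (Tsf.Gc i).graph.Vertex), Λv i (σ i v) ∈ verticialSubgroups (Tsf.chart i) v)
    (hΛv : ∀ i v, (Λv i v).map (StableCurveTemperedData.OfSpecialFibre.levelGraph (M.toTemperedCurve.ofOpenSubgroup (M.GtpXu l) (M.toThetaSetting.isOpen_GtpXu l) M.K (range_aug_GtpXu_eq_GK C) hDopen) Tsf Sigma SigmaHat hsub hne hprime i).ι = (G i).vertGp v)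
    (src tgt : ∀ i, (G i).graph.N → (G i).graph.V) (c₁ c₂ : ∀ i, (G i).graph.N → (Tsf.chart i).G)
    (hends : ∀ i e, (G i).graph.nodeEnds e = s(src i e, tgt i e))
    (h₁ : ∀ i e, (G i).nodeGp e ≤ MulAut.conj ((StableCurveTemperedData.OfSpecialFibre.levelGraph (M.toTemperedCurve.ofOpenSubgroup (M.GtpXu l) (M.toThetaSetting.isOpen_GtpXu l) M.K (range_aug_GtpXu_eq_GK C) hDopen) Tsf Sigma SigmaHat hsub hne hprime i).ι (c₁ i e)) • (G i).vertGp (src i e))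
    (h₂ : ∀ i e, (G i).nodeGp e ≤ MulAut.conj ((StableCurveTemperedData.OfSpecialFibre.levelGraph (M.toTemperedCurve.ofOpenSubgroup (M.GtpXu l) (M.toThetaSetting.isOpen_GtpXu l) M.K (range_aug_GtpXu_eq_GK C) hDopen) Tsf Sigma SigmaHat hsub hne hprime i).ι (c₂ i e)) • (G i).vertGp (tgt i e))
    (hloop : ∀ i e, src i e = tgt i e → (c₁ i e)⁻¹ * c₂ i e ∉ Λv i (src i e))
    -- the pro-`Σ` abelianization law along the admissible quotients ([IUTchI] p.50 l.33–36)
    (hab : ∀ (i : ℕ) (A : Type) [CommGroup A] [Finite A] (χ : Tsf.N i →* A),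
      IsOpen ((χ.ker : Subgroup (Tsf.N i)) : Set (Tsf.N i)) →
      (∀ q : ℕ, q.Prime → q ∣ Nat.card A → q ∈ Sigma) → (Tsf.adm i).toMonoidHom.ker ≤ χ.ker)
    -- the admissible kernels shrink to `1` ([IUTchI] p.50 l.45–49)
    (hadm : ∀ U ∈ 𝓝 (1 : ↥(M.toTemperedCurve.ofOpenSubgroup (M.GtpXu l) (M.toThetaSetting.isOpen_GtpXu l) M.K (range_aug_GtpXu_eq_GK C) hDopen).DeltaTemp), ∃ j,
      ((Tsf.admKer j : Subgroup ↥(M.toTemperedCurve.ofOpenSubgroup (M.GtpXu l) (M.toThetaSetting.isOpen_GtpXu l) M.K (range_aug_GtpXu_eq_GK C) hDopen).DeltaTemp) : Set ↥(M.toTemperedCurve.ofOpenSubgroup (M.GtpXu l) (M.toThetaSetting.isOpen_GtpXu l) M.K (range_aug_GtpXu_eq_GK C) hDopen).DeltaTemp) ⊆ U) :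
    ∃ (Cu : CuspidalInertiaData (ofPiCHat e C μ hC hS hl hp2 hpl hζ hη hZ hN T))
      (A : StableCurveAgreement (ofPiCHat e C μ hC hS hl hp2 hpl hζ hη hZ hN T) Cu
        (StableCurveTemperedData.ofSpecialFibre (M.toTemperedCurve.ofOpenSubgroup (M.GtpXu l) (M.toThetaSetting.isOpen_GtpXu l) M.K (range_aug_GtpXu_eq_GK C) hDopen) d Sf h36 Sigma SigmaHat hsub hne hprime hp TpH HatH hle cuspMeetsH)),
      IsHomeomorph A.eHat ∧
      (∀ x : T.Xplain,
        A.eHat ⟨(ofPiCHat e C μ hC hS hl hp2 hpl hζ hη hZ hN T).emb x, (ofPiCHat e C μ hC hS hl hp2 hpl hζ hη hZ hN T).emb_le_pmHat ⟨x, rfl⟩⟩ =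
          (StableCurveTemperedData.ofSpecialFibre (M.toTemperedCurve.ofOpenSubgroup (M.GtpXu l) (M.toThetaSetting.isOpen_GtpXu l) M.K (range_aug_GtpXu_eq_GK C) hDopen) d Sf h36 Sigma SigmaHat hsub hne hprime hp TpH HatH hle cuspMeetsH).ιX (T.plainIso x)) ∧
      (∀ (Q I : Subgroup (ofPiCHat e C μ hC hS hl hp2 hpl hζ hη hZ hN T).Corhat), Cu.IsCuspidalInertia Q I ↔
        I ≤ Q ∧ ∃ I₀, Cu.IsCuspidalInertia (ofPiCHat e C μ hC hS hl hp2 hpl hζ hη hZ hN T).piPM I₀ ∧ I = I₀ ⊓ Q) ∧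
      ∀ {L : LabCuspStructure Cu} (Ld : LabelledDecomposition Dec L),
        ∀ {I : Subgroup (ofPiCHat e C μ hC hS hl hp2 hpl hζ hη hZ hN T).Corhat},
          (∀ H : Subgroup P, Cor24_family Dec Ld H →
            ∃ (TpH' : Subgroup Sf.chart.G) (HatH' : Subgroup (TemperedGraphGroupData.exists_completion_of_prop36 Sf.Gc h36 Sf.chart).choose)
              (hle' : TpH'.map (TemperedGraphGroupData.exists_completion_of_prop36 Sf.Gc h36 Sf.chart).choose_spec.choose.toMonoidHom ≤ HatH')
              (cMH' : {x : (M.toTemperedCurve.ofOpenSubgroup (M.GtpXu l) (M.toThetaSetting.isOpen_GtpXu l) M.K (range_aug_GtpXu_eq_GK C) hDopen).Pt // (M.toTemperedCurve.ofOpenSubgroup (M.GtpXu l) (M.toThetaSetting.isOpen_GtpXu l) M.K (range_aug_GtpXu_eq_GK C) hDopen).IsCusp x} → Prop)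
              (_ : ((StableCurveTemperedData.ofSpecialFibre (M.toTemperedCurve.ofOpenSubgroup (M.GtpXu l) (M.toThetaSetting.isOpen_GtpXu l) M.K (range_aug_GtpXu_eq_GK C) hDopen) d Sf h36 Sigma SigmaHat hsub hne hprime hp TpH' HatH' hle' cMH').graph.HatH :
                  Set (StableCurveTemperedData.ofSpecialFibre (M.toTemperedCurve.ofOpenSubgroup (M.GtpXu l) (M.toThetaSetting.isOpen_GtpXu l) M.K (range_aug_GtpXu_eq_GK C) hDopen) d Sf h36 Sigma SigmaHat hsub hne hprime hp TpH' HatH' hle' cMH').graph.Hat) =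
                closure ((StableCurveTemperedData.ofSpecialFibre (M.toTemperedCurve.ofOpenSubgroup (M.GtpXu l) (M.toThetaSetting.isOpen_GtpXu l) M.K (range_aug_GtpXu_eq_GK C) hDopen) d Sf h36 Sigma SigmaHat hsub hne hprime hp TpH' HatH' hle' cMH').graph.ι ''
                  (StableCurveTemperedData.ofSpecialFibre (M.toTemperedCurve.ofOpenSubgroup (M.GtpXu l) (M.toThetaSetting.isOpen_GtpXu l) M.K (range_aug_GtpXu_eq_GK C) hDopen) d Sf h36 Sigma SigmaHat hsub hne hprime hp TpH' HatH' hle' cMH').graph.TpH))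
              (_ : H = ((StableCurveTemperedData.ofSpecialFibre (M.toTemperedCurve.ofOpenSubgroup (M.GtpXu l) (M.toThetaSetting.isOpen_GtpXu l) M.K (range_aug_GtpXu_eq_GK C) hDopen) d Sf h36 Sigma SigmaHat hsub hne hprime hp TpH' HatH' hle' cMH').piTpXH.comap
                  T.plainIso.toMulEquiv.toMonoidHom).comap T.incl)
              (_ : (StableCurveTemperedData.ofSpecialFibre (M.toTemperedCurve.ofOpenSubgroup (M.GtpXu l) (M.toThetaSetting.isOpen_GtpXu l) M.K (range_aug_GtpXu_eq_GK C) hDopen) d Sf h36 Sigma SigmaHat hsub hne hprime hp TpH' HatH' hle' cMH').Cor23Hyp)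
              (_ : (StableCurveTemperedData.ofSpecialFibre (M.toTemperedCurve.ofOpenSubgroup (M.GtpXu l) (M.toThetaSetting.isOpen_GtpXu l) M.K (range_aug_GtpXu_eq_GK C) hDopen) d Sf h36 Sigma SigmaHat hsub hne hprime hp TpH' HatH' hle' cMH').Cor23iii)
              (_ : (StableCurveTemperedData.ofSpecialFibre (M.toTemperedCurve.ofOpenSubgroup (M.GtpXu l) (M.toThetaSetting.isOpen_GtpXu l) M.K (range_aug_GtpXu_eq_GK C) hDopen) d Sf h36 Sigma SigmaHat hsub hne hprime hp TpH' HatH' hle' cMH').Cor23iv)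
              (_ : (StableCurveTemperedData.ofSpecialFibre (M.toTemperedCurve.ofOpenSubgroup (M.GtpXu l) (M.toThetaSetting.isOpen_GtpXu l) M.K (range_aug_GtpXu_eq_GK C) hDopen) d Sf h36 Sigma SigmaHat hsub hne hprime hp TpH' HatH' hle' cMH').Cor23v)
              (Tw : (StableCurveTemperedData.ofSpecialFibre (M.toTemperedCurve.ofOpenSubgroup (M.GtpXu l) (M.toThetaSetting.isOpen_GtpXu l) M.K (range_aug_GtpXu_eq_GK C) hDopen) d Sf h36 Sigma SigmaHat hsub hne hprime hp TpH' HatH' hle' cMH').Prop24Tower)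
              (V : Tw.I → Subgroup (StableCurveTemperedData.ofSpecialFibre (M.toTemperedCurve.ofOpenSubgroup (M.GtpXu l) (M.toThetaSetting.isOpen_GtpXu l) M.K (range_aug_GtpXu_eq_GK C) hDopen) d Sf h36 Sigma SigmaHat hsub hne hprime hp TpH' HatH' hle' cMH').graph.Hat)
              (_ : ∀ i (y : (StableCurveTemperedData.ofSpecialFibre (M.toTemperedCurve.ofOpenSubgroup (M.GtpXu l) (M.toThetaSetting.isOpen_GtpXu l) M.K (range_aug_GtpXu_eq_GK C) hDopen) d Sf h36 Sigma SigmaHat hsub hne hprime hp TpH' HatH' hle' cMH').DeltaHat),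
                (y : (StableCurveTemperedData.ofSpecialFibre (M.toTemperedCurve.ofOpenSubgroup (M.GtpXu l) (M.toThetaSetting.isOpen_GtpXu l) M.K (range_aug_GtpXu_eq_GK C) hDopen) d Sf h36 Sigma SigmaHat hsub hne hprime hp TpH' HatH' hle' cMH').PiHat) ∈ Tw.Jhat i ↔
                  (StableCurveTemperedData.ofSpecialFibre (M.toTemperedCurve.ofOpenSubgroup (M.GtpXu l) (M.toThetaSetting.isOpen_GtpXu l) M.K (range_aug_GtpXu_eq_GK C) hDopen) d Sf h36 Sigma SigmaHat hsub hne hprime hp TpH' HatH' hle' cMH').ρHat y ∈ V i)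
              (_ : ∀ i, (V i).Normal) (_ : ∀ i, IsOpen (V i : Set (StableCurveTemperedData.ofSpecialFibre (M.toTemperedCurve.ofOpenSubgroup (M.GtpXu l) (M.toThetaSetting.isOpen_GtpXu l) M.K (range_aug_GtpXu_eq_GK C) hDopen) d Sf h36 Sigma SigmaHat hsub hne hprime hp TpH' HatH' hle' cMH').graph.Hat))
              (_ : ∀ O ∈ 𝓝 (1 : (StableCurveTemperedData.ofSpecialFibre (M.toTemperedCurve.ofOpenSubgroup (M.GtpXu l) (M.toThetaSetting.isOpen_GtpXu l) M.K (range_aug_GtpXu_eq_GK C) hDopen) d Sf h36 Sigma SigmaHat hsub hne hprime hp TpH' HatH' hle' cMH').graph.Hat), ∃ i, (V i : Set _) ⊆ O)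
              (Cv : Tw.CoveringLevelGraphs) (Ad : ∀ i, Cv.toLevelData.LevelDatum i),
              (∀ i, (Ad i).lev.Cor23vi) ∧
              (∀ i (γ : (StableCurveTemperedData.ofSpecialFibre (M.toTemperedCurve.ofOpenSubgroup (M.GtpXu l) (M.toThetaSetting.isOpen_GtpXu l) M.K (range_aug_GtpXu_eq_GK C) hDopen) d Sf h36 Sigma SigmaHat hsub hne hprime hp TpH' HatH' hle' cMH').DeltaTp),
                (∀ v ∈ Cv.toLevelData.compH i, Cv.toLevelData.act i
                  (γ : (StableCurveTemperedData.ofSpecialFibre (M.toTemperedCurve.ofOpenSubgroup (M.GtpXu l) (M.toThetaSetting.isOpen_GtpXu l) M.K (range_aug_GtpXu_eq_GK C) hDopen) d Sf h36 Sigma SigmaHat hsub hne hprime hp TpH' HatH' hle' cMH').PiTp) v ∈ Cv.toLevelData.compH i) →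
                  ∃ ĥ ∈ (StableCurveTemperedData.ofSpecialFibre (M.toTemperedCurve.ofOpenSubgroup (M.GtpXu l) (M.toThetaSetting.isOpen_GtpXu l) M.K (range_aug_GtpXu_eq_GK C) hDopen) d Sf h36 Sigma SigmaHat hsub hne hprime hp TpH' HatH' hle' cMH').graph.HatH,
                    ĥ⁻¹ * (StableCurveTemperedData.ofSpecialFibre (M.toTemperedCurve.ofOpenSubgroup (M.GtpXu l) (M.toThetaSetting.isOpen_GtpXu l) M.K (range_aug_GtpXu_eq_GK C) hDopen) d Sf h36 Sigma SigmaHat hsub hne hprime hp TpH' HatH' hle' cMH').graph.ι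
                      ((StableCurveTemperedData.ofSpecialFibre (M.toTemperedCurve.ofOpenSubgroup (M.GtpXu l) (M.toThetaSetting.isOpen_GtpXu l) M.K (range_aug_GtpXu_eq_GK C) hDopen) d Sf h36 Sigma SigmaHat hsub hne hprime hp TpH' HatH' hle' cMH').ρTp γ) ∈ V i) ∧
              (∀ i, (Tw.Jhat i : Set (StableCurveTemperedData.ofSpecialFibre (M.toTemperedCurve.ofOpenSubgroup (M.GtpXu l) (M.toThetaSetting.isOpen_GtpXu l) M.K (range_aug_GtpXu_eq_GK C) hDopen) d Sf h36 Sigma SigmaHat hsub hne hprime hp TpH' HatH' hle' cMH').PiHat) ⊆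
                closure (((T.incl.range.map T.plainIso.toMulEquiv.toMonoidHom).map
                  (StableCurveTemperedData.ofSpecialFibre (M.toTemperedCurve.ofOpenSubgroup (M.GtpXu l) (M.toThetaSetting.isOpen_GtpXu l) M.K (range_aug_GtpXu_eq_GK C) hDopen) d Sf h36 Sigma SigmaHat hsub hne hprime hp TpH HatH hle cuspMeetsH).ιX : Subgroup _) : Set _))) →
          Literature.IUT.HodgeArakelov.Cor24_i' Dec (ofPiCHat e C μ hC hS hl hp2 hpl hζ hη hZ hN T) Cu Ld I := by
  obtain ⟨Cu, A, hhomeo, hA, hlev, h⟩ := cor24_i'_ofPiCHat_of_graphTower_comap e C μ hC hS hl hp2 hpl hζ hη hZ hN T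
    hDopen d Sf h36 Sigma SigmaHat hsub hne hprime hp TpH HatH hle cuspMeetsH Dec
  refine ⟨Cu, A, hhomeo, hA, hlev, fun Ld => ?_⟩
  intro I GT
  exact h Ld (StableCurveTemperedData.OfSpecialFibre.prop24i_ofPiData_byName _ d Tsf Sigma SigmaHat hsub hne hprime Sf
    h36 hp TpH HatH hle cuspMeetsH Psf hTF G hNN σ Λv hvert hΛv src tgt c₁ c₂ hends h₁ h₂ hloop hab hadm) GT

end PlusMinusTower

end Literature.IUT.HodgeArakelov

end
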